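import Literature.MathematicalPhysics.QuantumFieldTheory.Balaban1983to89.B6DeltaPrimeKernelTwoScaleV1
import Literature.MathematicalPhysics.QuantumFieldTheory.Balaban1983to89.B5Hk163TorusHolderRate

/-!
# `Balaban1983to89.B6Cov2110WeightV1` — T. Bałaban, *Propagators and renormalization transformations for lattice gauge
# theories. II*, Commun. Math. Phys. **96** (1984) 223–250 [Balaban1984PropagatorsII], p. 242 (text after (2.110)): *«a covariance C^{(j)}_Λ …
# with an exponential decay independent of j and Λ»* — INPUTS (c) and (d, first half) OF THE COMBES–THOMAS ROUTE FOR THE CONCRETE TWO-SCALE DATA: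
# the block-anchored torus weight on the unit torus `T^{(j)}` is Lipschitz up to `2(L − 1)`, and the symmetric Schur bound that turns a row-sum
# estimate into the conjugation-error hypothesis `hSe` of the same seat's `…B6Cov2110MatrixV1.cov_kernel_decay_of_herr` (elementary `e^t − 1 ≤ te^t`, `te^{−at} ≤ 1/a` are in the tree: `…AreaLaw.exp_sub_one_le_mul_exp`, `Literature.NumberTheory.LFunctions.MoebiusDyadic.mul_exp_neg_le_inv`)

statement-level skeleton of published theorems with citation tags; proofs where landed; nothing here is a claim about the Yang–Mills mass gap

PDF held: `paper:balaban1984-cmp96-propagators-rt-ii` (journal page = PDF page + 222; p. 242 [PDF 20] read AS IMAGE on the ×2 render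
`run/shared/lean/pub/pub-balaban/b2b-balaban-ref1/pages/1984-cmp96-propagators-rt-II/…-p020-x2.png`, 2026-08-21).

PRINT (verbatim, p. 242).  *"From the theorem on unit lattice operators in [3] it follows that a covariance C^{(j)}_Λ of the last Gaussian integrals
in (2.106) is a bounded operator with an exponential decay independent of j and Λ."*

CITATION HEADER (lean-in-tree rule) — WHAT IS REPRODUCED.  Phase-2 file of the `lit-balaban` typed skeleton (HOME
`run/shared/lean/pub/lit-balaban/`), seat **p22 gen 11** (B6 fold owner r03, referee ref-4; lane = the Sect. C chain (2.95)–(2.147) on the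
concrete two-scale data `tsV1`).  SKELETON row **B6.Eq2.110** (*"(2.110) + C^{(j)}_Λ"*, the «exponential decay» clause — NOT yet instanced; this file
is bookkeeping toward it, successor plan `lit-balaban-p22/GEN12-PLAN.md` item 1).  IMPORTS BY NAME: `B4TorusKernel.MultiPeriod.torusSupNorm/circAbs`,
`B4Sect5Torus.circAbs_add_le/_neg/_zero`, `B6LowerBound2153Torus.rep`, `TorusGeometry.Site.val_blockSite`, p08's `exists_blockSite_eq`.  THIS FILE
(parameter set written `⟨d + 1, L, m, K, _, _⟩` as r03's torus sup-metric is `Fin (d + 1)`-indexed — every `P : Params` has this form):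
* §1 **`torusSupNorm_anchor_le`**: every site of `T^{(j)}` is within `L − 1` (torus sup-metric of lattice representatives) of the anchor
  `x̂ = blockSite (y(x)) 0` of its block; **`weight_sub_le`**: the block-constant weight `φ(x) = δ|x̂ − a|_T` satisfies
  `|φ(x) − φ(x′)| ≤ δ(|x − x′|_T + 2(L − 1))` (triangle inequality `torusSupNorm_sub_le`, `abs_torusSupNorm_sub_sub_le`);
* §2 **`schur_symm`** (`Σ_{a,b}k_{ab}|v_a||v_b| ≤ R‖v‖²` for a
  symmetric non-negative kernel with row sums `≤ R`), **`conjError_ge`** (the Combes–Thomas conjugation error is `≥ −Σ k_{ab}|v_a||v_b|` whenever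
  `|e^{ψ_a−ψ_b} − 1||S_{ab}| ≤ k_{ab}`).
THEOREMS ONLY (no definition, no `def … : Prop` fact); standard axioms.  HONEST SCOPE: bookkeeping only; what remains for the decay of `C^{(j)}_Λ`
(GEN12-PLAN item 1 (d)): the row-sum bound `Σ_{x′}(e^{δ(|x−x′|_T + 2(L−1))} − 1)|⟨e_x, Δ′_je_{x′}⟩| ≤ θ·C(d,L)·δ` from
`…B6DeltaPrimeKernelTwoScaleV1.kernel_Dp_decay_rep` and `…B5Hk163TorusHolderRate.sum_exp_torusSupNorm_sub_rep_le`, the choice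
`δ₀(d,L) = min(κ/2, c₀(8/L²)²/(2(C + 1)))`, and the assembly with `…B6Cov2110MatrixV1.cov_kernel_decay_of_herr`; finite tori, `L` odd; NOT summit
progress.
-/

noncomputable section

open scoped InnerProductSpace
open Finset Matrix

namespace Literature.MathematicalPhysics.QuantumFieldTheory.Balaban1983to89.B6Cov2110WeightV1

open LatticeFieldCalculus B6SectAOperatorsV1 B6SectCTwoScaleV1 B6SectCTwoScaleV1Lattice
open B5Prop11Plancherel (Tor)
open B4TorusKernel.MultiPeriod (circAbs circAbs_le_abs circAbs_nonneg torusSupNorm)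
open B5Eq117TorusCarriers (Mk)
open B4Sect5Torus (circAbs_zero circAbs_neg circAbs_add_le)
open B6LowerBound2153Torus (rep)
open B6Cov2156Torus (one_le_M)
open BalabanImbrieJaffe1984to88.BIJ85GaugeFunction5113 (exists_blockSite_eq)

/-! ## §1  The torus sup-metric on `T^{(j)}`: triangle inequality and the block anchors -/

section Torus

variable {d : ℕ} (M : Fin (d + 1) → ℕ) [hM : ∀ μ, NeZero (M μ)]

/-- the triangle inequality `|x + z|_T ≤ |x|_T + |z|_T` of the torus sup-metric. [folklore] -/
private theorem torusSupNorm_add_le (x z : Fin (d + 1) → ℤ) : torusSupNorm M (x + z) ≤ torusSupNorm M x + torusSupNorm M z := by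
  unfold torusSupNorm
  refine Finset.sup'_le _ _ fun i _ => ?_
  have h1 : ((circAbs (M i) ((x + z) i) : ℤ) : ℝ) ≤ ((circAbs (M i) (x i) : ℤ) : ℝ) + ((circAbs (M i) (z i) : ℤ) : ℝ) := by
    rw [Pi.add_apply]
    exact_mod_cast circAbs_add_le (one_le_M M i) (x i) (z i)
  exact h1.trans (add_le_add (Finset.le_sup' (fun i => ((circAbs (M i) (x i) : ℤ) : ℝ)) (Finset.mem_univ i))
    (Finset.le_sup' (fun i => ((circAbs (M i) (z i) : ℤ) : ℝ)) (Finset.mem_univ i)))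

/-- symmetry `|−x|_T = |x|_T`. [cite: Balaban1984PropagatorsI, (1.29) p.23] -/
theorem torusSupNorm_neg (x : Fin (d + 1) → ℤ) : torusSupNorm M (-x) = torusSupNorm M x := by
  unfold torusSupNorm
  congr 1
  funext i
  rw [Pi.neg_apply, circAbs_neg (one_le_M M i)]

omit hM in
/-- `|0|_T = 0`. [cite: Balaban1984PropagatorsI, (1.29) p.23] -/
theorem torusSupNorm_zero : torusSupNorm M 0 = 0 := by
  unfold torusSupNorm
  simp only [Pi.zero_apply, circAbs_zero, Int.cast_zero]
  exact Finset.sup'_const _ _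

/-- `|a − c|_T ≤ |a − b|_T + |b − c|_T`. [cite: Balaban1984PropagatorsI, (1.29) p.23] -/
theorem torusSupNorm_sub_le (a b c : Fin (d + 1) → ℤ) :
    torusSupNorm M (a - c) ≤ torusSupNorm M (a - b) + torusSupNorm M (b - c) := by
  have h := torusSupNorm_add_le M (a - b) (b - c)
  rwa [show a - b + (b - c) = a - c by abel] at h

/-- reverse triangle inequality `| |a − c|_T − |b − c|_T | ≤ |a − b|_T`. [cite: Balaban1984PropagatorsI, (1.29) p.23] -/
theorem abs_torusSupNorm_sub_sub_le (a b c : Fin (d + 1) → ℤ) :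
    |torusSupNorm M (a - c) - torusSupNorm M (b - c)| ≤ torusSupNorm M (a - b) := by
  rw [abs_sub_le_iff]
  constructor
  · linarith [torusSupNorm_sub_le M a b c]
  · have h := torusSupNorm_sub_le M b a c
    rw [← torusSupNorm_neg M (b - a), neg_sub] at h
    linarith

end Torus

section Anchor

variable {d L m K : ℕ} {hd : 1 ≤ d + 1} {hL : Odd L ∧ 1 < L} {j : ℕ}

/-- **every site is within `L − 1` of the anchor of its block**: `|x − x̂|_T ≤ L − 1`, `x̂ = blockSite (y(x)) 0` (the labels differ by the block
offset `r ∈ {0,…,L−1}^{d+1}`, no wrap-around). [cite: Balaban1984PropagatorsI, (1.6) p.18] -/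
theorem torusSupNorm_anchor_le (hj : j + 1 ≤ m + K) (x : Site (⟨d + 1, L, m, K, hd, hL⟩ : Params) j) :
    torusSupNorm (Mk ⟨d + 1, L, m, K, hd, hL⟩ j)
        (rep (Mk ⟨d + 1, L, m, K, hd, hL⟩ j) x -
          rep (Mk ⟨d + 1, L, m, K, hd, hL⟩ j) (Site.blockSite (blockOf x) (fun _ => ⟨0, Params.L_pos _⟩))) ≤ (L : ℝ) - 1 := by
  obtain ⟨r, hr⟩ := exists_blockSite_eq (P := ⟨d + 1, L, m, K, hd, hL⟩) hj x
  have hdiff : ∀ i, rep (Mk ⟨d + 1, L, m, K, hd, hL⟩ j) x i -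
      rep (Mk ⟨d + 1, L, m, K, hd, hL⟩ j) (Site.blockSite (blockOf x) (fun _ => ⟨0, Params.L_pos _⟩)) i = ((r i : ℕ) : ℤ) := by
    intro i
    simp only [rep]
    conv_lhs => rw [← hr]
    rw [Site.val_blockSite (P := ⟨d + 1, L, m, K, hd, hL⟩) hj, Site.val_blockSite (P := ⟨d + 1, L, m, K, hd, hL⟩) hj,
      Site.blockOf_blockSite (P := ⟨d + 1, L, m, K, hd, hL⟩) hj]
    push_cast
    ring
  unfold torusSupNorm
  refine Finset.sup'_le _ _ fun i _ => ?_
  rw [Pi.sub_apply, hdiff i]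
  have h1 := circAbs_le_abs (one_le_M (Mk ⟨d + 1, L, m, K, hd, hL⟩ j) i) ((r i : ℕ) : ℤ)
  have h2 : ((r i : ℕ) : ℤ) < L := by exact_mod_cast (r i).isLt
  have h3 : (circAbs (Mk ⟨d + 1, L, m, K, hd, hL⟩ j i) ((r i : ℕ) : ℤ) : ℤ) ≤ (L : ℤ) - 1 := by
    rw [abs_of_nonneg (by positivity)] at h1
    omega
  exact_mod_cast h3

/-- **Lipschitz bound for the block-anchored weight**: with `φ(x) = δ·|x̂ − a|_T` (`δ ≥ 0`, any base point `a`),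
`|φ(x) − φ(x′)| ≤ δ·(|x − x′|_T + 2(L − 1))`. [cite: Balaban1984PropagatorsII, p.242 (text after (2.110))] -/
theorem weight_sub_le (hj : j + 1 ≤ m + K) {δ : ℝ} (hδ : 0 ≤ δ) (a : Fin (d + 1) → ℤ) (x x' : Site (⟨d + 1, L, m, K, hd, hL⟩ : Params) j) :
    |δ * torusSupNorm (Mk ⟨d + 1, L, m, K, hd, hL⟩ j)
          (rep (Mk ⟨d + 1, L, m, K, hd, hL⟩ j) (Site.blockSite (blockOf x) (fun _ => ⟨0, Params.L_pos _⟩)) - a) -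
        δ * torusSupNorm (Mk ⟨d + 1, L, m, K, hd, hL⟩ j)
          (rep (Mk ⟨d + 1, L, m, K, hd, hL⟩ j) (Site.blockSite (blockOf x') (fun _ => ⟨0, Params.L_pos _⟩)) - a)| ≤
      δ * (torusSupNorm (Mk ⟨d + 1, L, m, K, hd, hL⟩ j) (rep (Mk ⟨d + 1, L, m, K, hd, hL⟩ j) x - rep (Mk ⟨d + 1, L, m, K, hd, hL⟩ j) x') +
        2 * ((L : ℝ) - 1)) := by
  set M := Mk (⟨d + 1, L, m, K, hd, hL⟩ : Params) j with hMdef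
  set ax := rep M (Site.blockSite (blockOf x) (fun _ => ⟨0, Params.L_pos _⟩)) with hax
  set ax' := rep M (Site.blockSite (blockOf x') (fun _ => ⟨0, Params.L_pos _⟩)) with hax'
  rw [← mul_sub, abs_mul, abs_of_nonneg hδ]
  refine mul_le_mul_of_nonneg_left ?_ hδ
  have h1 := abs_torusSupNorm_sub_sub_le M ax ax' a
  have h2 : torusSupNorm M (ax - ax') ≤ torusSupNorm M (ax - rep M x) + torusSupNorm M (rep M x - rep M x') + torusSupNorm M (rep M x' - ax') :=
    (torusSupNorm_sub_le M ax (rep M x') ax').trans (by linarith [torusSupNorm_sub_le M ax (rep M x) (rep M x')])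
  have h3 : torusSupNorm M (ax - rep M x) ≤ (L : ℝ) - 1 := by
    rw [← torusSupNorm_neg M, neg_sub]
    exact torusSupNorm_anchor_le hj x
  have h4 : torusSupNorm M (rep M x' - ax') ≤ (L : ℝ) - 1 := torusSupNorm_anchor_le hj x'
  linarith

end Anchor

/-! ## §2  Elementary inequalities and the symmetric Schur bound -/

section Elementary

variable {ι : Type*} [Fintype ι]

/-- **symmetric Schur bound**: for a symmetric non-negative kernel `k` with row sums `≤ R`, `Σ_{a,b} k(a,b)|v_a||v_b| ≤ R·Σ_a v_a²`.
[cite: CombesThomas1973, §II] -/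
theorem schur_symm (k : ι → ι → ℝ) (hk : ∀ a b, k a b = k b a) (hk0 : ∀ a b, 0 ≤ k a b) {R : ℝ}
    (hR : ∀ a, ∑ b, k a b ≤ R) (v : ι → ℝ) : ∑ a, ∑ b, k a b * (|v a| * |v b|) ≤ R * ∑ a, v a ^ 2 := by
  have h1 : ∀ a b, k a b * (|v a| * |v b|) ≤ k a b * ((v a ^ 2 + v b ^ 2) / 2) := fun a b =>
    mul_le_mul_of_nonneg_left (by nlinarith [sq_nonneg (|v a| - |v b|), sq_abs (v a), sq_abs (v b)]) (hk0 a b)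
  have h2 : ∑ a, ∑ b, k a b * ((v a ^ 2 + v b ^ 2) / 2) = ∑ a, v a ^ 2 * ∑ b, k a b := by
    have h3 : ∑ a, ∑ b, k a b * (v b ^ 2 / 2) = ∑ a, ∑ b, k a b * (v a ^ 2 / 2) := by
      rw [Finset.sum_comm]
      exact Finset.sum_congr rfl fun a _ => Finset.sum_congr rfl fun b _ => by rw [hk]
    have h4 : ∑ a, ∑ b, k a b * ((v a ^ 2 + v b ^ 2) / 2) = ∑ a, ∑ b, k a b * (v a ^ 2 / 2) + ∑ a, ∑ b, k a b * (v b ^ 2 / 2) := by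
      rw [← Finset.sum_add_distrib]
      exact Finset.sum_congr rfl fun a _ => by rw [← Finset.sum_add_distrib]; exact Finset.sum_congr rfl fun b _ => by ring
    rw [h4, h3, ← Finset.sum_add_distrib]
    refine Finset.sum_congr rfl fun a _ => ?_
    rw [← Finset.sum_add_distrib, Finset.mul_sum]
    exact Finset.sum_congr rfl fun b _ => by ring
  calc ∑ a, ∑ b, k a b * (|v a| * |v b|) ≤ ∑ a, ∑ b, k a b * ((v a ^ 2 + v b ^ 2) / 2) :=
        Finset.sum_le_sum fun a _ => Finset.sum_le_sum fun b _ => h1 a b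
    _ = ∑ a, v a ^ 2 * ∑ b, k a b := h2
    _ ≤ ∑ a, v a ^ 2 * R := Finset.sum_le_sum fun a _ => mul_le_mul_of_nonneg_left (hR a) (sq_nonneg _)
    _ = R * ∑ a, v a ^ 2 := by rw [← Finset.sum_mul, mul_comm]

/-- the Combes–Thomas conjugation error is bounded below by minus the Schur majorant. [cite: CombesThomas1973, §II] -/
theorem conjError_ge (S : Matrix ι ι ℝ) (ψ : ι → ℝ) (k : ι → ι → ℝ)
    (hbound : ∀ a b, |Real.exp (ψ a - ψ b) - 1| * |S a b| ≤ k a b) (v : ι → ℝ) :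
    -(∑ a, ∑ b, k a b * (|v a| * |v b|)) ≤ ∑ a, ∑ b, (Real.exp (ψ a - ψ b) - 1) * S a b * (v a * v b) := by
  rw [← Finset.sum_neg_distrib]
  refine Finset.sum_le_sum fun a _ => ?_
  rw [← Finset.sum_neg_distrib]
  refine Finset.sum_le_sum fun b _ => ?_
  have h1 : |(Real.exp (ψ a - ψ b) - 1) * S a b * (v a * v b)| ≤ k a b * (|v a| * |v b|) := by
    rw [abs_mul, abs_mul, abs_mul]
    exact mul_le_mul_of_nonneg_right (hbound a b) (by positivity)
  linarith [neg_abs_le ((Real.exp (ψ a - ψ b) - 1) * S a b * (v a * v b))]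

end Elementary

end Literature.MathematicalPhysics.QuantumFieldTheory.Balaban1983to89.B6Cov2110WeightV1

end
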